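import Summits.AtomisticToContinuum.BoseEinsteinCondensation.Theorems.BECPhaseQuadratureSumRuleSumRuleChainGlueEnergy
import HarnessLib

/-!
# Route `BECPhaseQuadratureSumRule`, glue `SumRuleChainGlue` (stmt-AtomisticToContinuum-12627) —
# helper: scale algebra at density `ρ`

The elementary identities behind the constants of the chain: with `K₀ = Λ√(ρa)`, `M = LK₀/2π`, `ρL³ = N`,
`ℓ = K₀⁻¹`, `η = ρ^{3/4} = √ρ·ρ^{1/4}`: `(L/2π)M² = NΛ²a/(2π)³`, `M³ = NΛ³a√a√ρ/(2π)³`,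
`ηρℓ³ = ρ^{1/4}/(Λ³a√a)`, `ρ/η = ρ^{1/4}`, and the ultraviolet tail under `Λ²a = 1024πR₀`:
`(N-1)K₀⁻²·16πR₀ρN ≤ N²/64`.
-/

noncomputable section

open scoped ENNReal NNReal

namespace Summit.AtomisticToContinuum.BoseEinsteinCondensation.Theorems.SumRuleChainGlue

open Literature.MathematicalPhysics.QuantumManyBody.BoseGas

/-- `(L/2π)M² = N Λ²a/(2π)³` for `M = LK₀/2π`, `K₀ = Λ√(ρa)`, `ρL³ = N`. -/
theorem window_sq_eq {L Λ ρ a N : ℝ} (hρ : 0 < ρ) (ha : 0 < a) (hN : ρ * L ^ 3 = N) :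
    L / (2 * Real.pi) * (L * (Λ * Real.sqrt (ρ * a)) / (2 * Real.pi)) ^ 2 = N * (Λ ^ 2 * a / (2 * Real.pi) ^ 3) := by
  have hs : Real.sqrt (ρ * a) ^ 2 = ρ * a := Real.sq_sqrt (by positivity)
  calc L / (2 * Real.pi) * (L * (Λ * Real.sqrt (ρ * a)) / (2 * Real.pi)) ^ 2
      = L ^ 3 * Λ ^ 2 * Real.sqrt (ρ * a) ^ 2 / (2 * Real.pi) ^ 3 := by ring
    _ = N * (Λ ^ 2 * a / (2 * Real.pi) ^ 3) := by rw [hs, ← hN]; ring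

/-- `M³ = N Λ³a√a√ρ/(2π)³`. -/
theorem window_cube_eq {L Λ ρ a N : ℝ} (hρ : 0 < ρ) (ha : 0 < a) (hN : ρ * L ^ 3 = N) :
    (L * (Λ * Real.sqrt (ρ * a)) / (2 * Real.pi)) ^ 3 = N * (Λ ^ 3 * a * Real.sqrt a * Real.sqrt ρ / (2 * Real.pi) ^ 3) := by
  have hs : Real.sqrt ρ ^ 2 = ρ := Real.sq_sqrt hρ.le
  have hsa : Real.sqrt a ^ 2 = a := Real.sq_sqrt ha.le
  have h3 : Real.sqrt ρ ^ 3 = ρ * Real.sqrt ρ := by rw [pow_succ, hs]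
  have h3a : Real.sqrt a ^ 3 = a * Real.sqrt a := by rw [pow_succ, hsa]
  calc (L * (Λ * Real.sqrt (ρ * a)) / (2 * Real.pi)) ^ 3
      = L ^ 3 * Λ ^ 3 * Real.sqrt (ρ * a) ^ 3 / (2 * Real.pi) ^ 3 := by ring
    _ = N * (Λ ^ 3 * a * Real.sqrt a * Real.sqrt ρ / (2 * Real.pi) ^ 3) := by
        rw [Real.sqrt_mul hρ.le, mul_pow, h3, h3a, ← hN]; ring

/-- `η ρ ℓ³ = ρ^{1/4}/(Λ³a√a)` for `η = ρ^{3/4} = √ρ·ρ^{1/4}`, `ℓ = (Λ√(ρa))⁻¹`. -/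
theorem eta_mul_rho_ell_cube {Λ ρ a : ℝ} (hΛ : 0 < Λ) (hρ : 0 < ρ) (ha : 0 < a) :
    Real.sqrt ρ * Real.sqrt (Real.sqrt ρ) * ρ * (Λ * Real.sqrt (ρ * a))⁻¹ ^ 3 =
      Real.sqrt (Real.sqrt ρ) / (Λ ^ 3 * a * Real.sqrt a) := by
  have hs : Real.sqrt ρ ^ 2 = ρ := Real.sq_sqrt hρ.le
  have hsa : Real.sqrt a ^ 2 = a := Real.sq_sqrt ha.le
  have h3 : Real.sqrt ρ ^ 3 = ρ * Real.sqrt ρ := by rw [pow_succ, hs]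
  have h3a : Real.sqrt a ^ 3 = a * Real.sqrt a := by rw [pow_succ, hsa]
  have hspos : 0 < Real.sqrt ρ := Real.sqrt_pos.2 hρ
  have hsapos : 0 < Real.sqrt a := Real.sqrt_pos.2 ha
  rw [Real.sqrt_mul hρ.le, inv_pow, mul_pow, mul_pow, h3, h3a]
  field_simp

/-- `ρ/η = ρ^{1/4}`. -/
theorem rho_div_eta {ρ : ℝ} (hρ : 0 < ρ) :
    ρ / (Real.sqrt ρ * Real.sqrt (Real.sqrt ρ)) = Real.sqrt (Real.sqrt ρ) := by
  have hs : Real.sqrt ρ ^ 2 = ρ := Real.sq_sqrt hρ.le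
  have hq : Real.sqrt (Real.sqrt ρ) ^ 2 = Real.sqrt ρ := Real.sq_sqrt (Real.sqrt_nonneg _)
  have hspos : 0 < Real.sqrt ρ := Real.sqrt_pos.2 hρ
  have hqpos : 0 < Real.sqrt (Real.sqrt ρ) := Real.sqrt_pos.2 hspos
  rw [div_eq_iff (by positivity)]
  calc ρ = Real.sqrt ρ ^ 2 := hs.symm
    _ = Real.sqrt ρ * Real.sqrt (Real.sqrt ρ) ^ 2 := by rw [hq, sq]
    _ = Real.sqrt (Real.sqrt ρ) * (Real.sqrt ρ * Real.sqrt (Real.sqrt ρ)) := by ring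

/-- **The ultraviolet tail under the choice `Λ²a = 1024πR₀`**: `(N-1)K₀⁻²·16πR₀ρN ≤ N²/64`. -/
theorem uv_const_le {Λ ρ a R₀ : ℝ} (hρ : 0 < ρ) (ha : 0 < a) (hR₀ : 0 < R₀) (hΛ2 : Λ ^ 2 * a = 1024 * Real.pi * R₀)
    (n : ℕ) :
    ((n + 1 : ℕ) : ℝ≥0∞) * ENNReal.ofReal (((Λ * Real.sqrt (ρ * a)) ^ 2)⁻¹) *
        ENNReal.ofReal (16 * Real.pi * R₀ * ρ * ((n + 2 : ℕ) : ℝ)) ≤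
      ENNReal.ofReal (1 / 64 * ((n + 2 : ℕ) : ℝ) ^ 2) := by
  rw [← ENNReal.ofReal_natCast, ← ENNReal.ofReal_mul (by positivity), ← ENNReal.ofReal_mul (by positivity)]
  refine ENNReal.ofReal_le_ofReal ?_
  have hK : (Λ * Real.sqrt (ρ * a)) ^ 2 = 1024 * Real.pi * R₀ * ρ := by
    rw [mul_pow, Real.sq_sqrt (by positivity), ← hΛ2]; ring
  rw [hK]
  have hn : ((n + 1 : ℕ) : ℝ) ≤ ((n + 2 : ℕ) : ℝ) := by exact_mod_cast Nat.le_succ _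
  have hpos : 0 < 1024 * Real.pi * R₀ * ρ := by positivity
  have heq : ((n + 1 : ℕ) : ℝ) * (1024 * Real.pi * R₀ * ρ)⁻¹ * (16 * Real.pi * R₀ * ρ * ((n + 2 : ℕ) : ℝ)) =
      ((n + 1 : ℕ) : ℝ) * ((n + 2 : ℕ) : ℝ) / 64 := by
    field_simp
    ring
  rw [heq]
  have hN0 : (0 : ℝ) ≤ ((n + 2 : ℕ) : ℝ) := by positivity
  nlinarith [mul_le_mul_of_nonneg_right hn hN0]

end Summit.AtomisticToContinuum.BoseEinsteinCondensation.Theorems.SumRuleChainGlue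

end
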